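import Mathlib
import HarnessLib
import Literature.MathematicalPhysics.QuantumLattice.HubbardFermiRadiusBand
import Literature.MathematicalPhysics.QuantumLattice.KohnLuttinger
import Summits.HubbardSuperconductivity.HubbardSuperconductivity.Theorems.WeakCouplingBCSKlCertTPrimePHReflectionShift

/-!
# Route `WeakCouplingBCS` — certificate vocabulary for `WcbcsKohnLuttingerB1g` (stmt-HubbardSuperconductivity-0158):
# the POLAR RADIUS of the `t`–`t′` band Fermi curve — brick (N1)-1 of the successor programme «TPRIME-LINDHARD-HS»

Cell `gate-hubbard-kl`, seat margin-1 (g18), zero kit; executed for the p4 lineage's programme «TPRIME-LINDHARD-HS» (scope memo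
`HOME/prover-p4/E2-TPRIME-LINDHARD-SCOPE.md`, pen (R461)(B): the χ₀ Hilbert–Schmidt row of the `t′ ≠ 0` records needs (N1) a polar CHART of the pocket,
(N2) a shell-volume estimate — ✓ at the `(⅛, −0.3)` cell, p4 g23 — and (N3) the torus sublevel estimate).  This file is the `t′`-twin of
`Literature/MathematicalPhysics/QuantumLattice/HubbardFermiRadiusBand.lean` §§1–3 (which treats `ε₀ = squareDispersion 1 0`, `−4 < μ < 0`): existence,
uniqueness and the square/transversality bounds of the polar radius, for every `|t′| < 1/2`; continuity and smoothness (the twins of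
`HubbardFermiRadiusBandContinuous/Smooth`) are brick (N1)-2.

* §1 `kltpRay tp θ t = ε_{t′}(t·dir θ) = −2(cos(t cos θ) + cos(t sin θ)) − 4t′cos(t cos θ)cos(t sin θ)` (`squareDispersion_toLp_smul_dir`; at `t′ = 0` it is
  the tree's `rayDispersion`, `kltpRay_zero_tp`), its radial derivative `kltpRayDt` (`hasDerivAt_kltpRay`).
* §2 **radial strict monotonicity inside the open square for every `|t′| < 1/2`** (`kltpRayDt_pos_of_lt_exit`, `strictMonoOn_kltpRay`):
  `∂_t ε_{t′}(t·dir θ) = 2cos θ sin(t cos θ)(1 + 2t′cos(t sin θ)) + 2 sin θ sin(t sin θ)(1 + 2t′cos(t cos θ)) > 0` since `a sin(ta) ≥ 0` for `|ta| ≤ π`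
  (strictly on the coordinate realising the sup norm) and `1 + 2t′cos ≥ 1 − 2|t′| > 0`; values `−4 − 4t′` at the centre and `≥ 4t′` (the van Hove level) at
  the exit `t = π/‖dir θ‖` (`kltpRay_exit_ge`).
* §3 **`existsUnique_isKltpRadius`**: for `|t′| < 1/2` and `−4 − 4t′ < μ < 4t′` every ray from `Γ` meets `{ε_{t′} = μ}` exactly once in the closed square;
  `kltpRadius tp μ θ` (Hilbert `ε`), `kltpRay_kltpRadius`, `kltpRadius_unique`, `kltpRadius_pos`, `kltpRadius_lt_exit`, `norm_kltpRadius_smul_dir_lt`,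
  `kltpRayDt_kltpRadius_pos` (transversality).
* §4 `kltpPolar tp μ θ : Momentum` lies on `fermiCurve (squareDispersion 1 t′) μ` (`kltpPolar_mem_fermiCurve`); **at `t′ = 0` the radius IS `bandFermiRadius`**
  and the point IS `fermiPolar` (`kltpRadius_zero_tp`, `kltpPolar_zero_tp`) — ADDITIVE, nothing restated.
* §5 the HOLE POCKET about `M = (π, π)` (`t′ < 0`, `4t′ < μ < 4 − 4t′`, e.g. the `(⅛, −0.3)` cell): by `ε_{t′}(T k) = −ε_{−t′}(k)`
  (`klph_squareDispersion_shift`, `klphShift_preimage_fermiCurve`, p4 g19) the M-pocket of `ε_{t′}` at `μ` is the `(π, π)`-shift of the Γ-pocket of `ε_{−t′}`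
  at `−μ`: `kltpPocketPolar tp μ θ := klphShift (kltpPolar (−t′) (−μ) θ) ∈ fermiCurve (squareDispersion 1 t′) μ` (`kltpPocketPolar_mem_fermiCurve`).

Definitions: `kltpRay`, `kltpRayDt`, `IsKltpRadius`, `kltpRadius`, `kltpPolar`, `kltpPocketPolar` (no `instance`, no `notation`).  Nothing here asserts a record, a
margin, `K₃`, `U₀`, the window or superconductivity; a Kohn–Luttinger `O(U²)` channel statement is not ODLRO; nothing here proves superconductivity in the
Hubbard model.
References: G. Benfatto, A. Giuliani, V. Mastropietro, Ann. Henri Poincaré 7 (2006) 809–898, §1 (1.4)–(1.5) (the polar description at `t′ = 0`);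
S. Raghu, S. A. Kivelson, D. J. Scalapino, Phys. Rev. B 81 (2010) 224505, §III (the `t`–`t′` band, its van Hove level `4t′`).
-/

noncomputable section

-- the tree's namespace `Summit.<Summit>.<Problem>.Theorems` repeats the summit name by design (D-0017)
set_option linter.dupNamespace false

namespace Summit.HubbardSuperconductivity.HubbardSuperconductivity.Theorems

open Real Set Filter Literature.MathematicalPhysics.QuantumLattice
open scoped Topology

/-! ### §1 The `t′` ray function `F_{t′}(θ, t) = ε_{t′}(t · dir θ)` and its radial derivative -/

/-- The `t`–`t′` band along the ray of angle `θ` from `Γ`: `kltpRay tp θ t = ε_{t′}(t cos θ, t sin θ)`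
`= −2 (cos (t cos θ) + cos (t sin θ)) − 4t′ cos (t cos θ) cos (t sin θ)` (`squareDispersion 1 tp` at the point `t · dir θ`). [folklore] -/
def kltpRay (tp θ t : ℝ) : ℝ :=
  -2 * (Real.cos (t * Real.cos θ) + Real.cos (t * Real.sin θ)) - 4 * tp * Real.cos (t * Real.cos θ) * Real.cos (t * Real.sin θ)

/-- `kltpRay` IS the dispersion at the ray point. [folklore] -/
theorem squareDispersion_toLp_smul_dir (tp θ t : ℝ) :
    squareDispersion 1 tp (WithLp.toLp 2 (t • dir θ)) = kltpRay tp θ t := by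
  simp [squareDispersion, kltpRay, dir, smul_eq_mul]

/-- At `t′ = 0` the ray function is the tree's `rayDispersion`. [folklore] -/
theorem kltpRay_zero_tp (θ t : ℝ) : kltpRay 0 θ t = rayDispersion (θ, t) := by
  rw [rayDispersion_eq, kltpRay]; ring

/-- The radial derivative `∂_t F_{t′}(θ, t) = 2 cos θ sin(t cos θ)(1 + 2t′cos(t sin θ)) + 2 sin θ sin(t sin θ)(1 + 2t′cos(t cos θ))`. [folklore] -/
def kltpRayDt (tp θ t : ℝ) : ℝ :=
  2 * Real.cos θ * Real.sin (t * Real.cos θ) * (1 + 2 * tp * Real.cos (t * Real.sin θ)) +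
    2 * Real.sin θ * Real.sin (t * Real.sin θ) * (1 + 2 * tp * Real.cos (t * Real.cos θ))

/-- `∂_t F_{t′}`: the derivative of `t ↦ F_{t′}(θ, t)`. [folklore] -/
theorem hasDerivAt_kltpRay (tp θ t : ℝ) : HasDerivAt (kltpRay tp θ) (kltpRayDt tp θ t) t := by
  have h0 : HasDerivAt (fun s => Real.cos (s * Real.cos θ)) (-Real.sin (t * Real.cos θ) * (1 * Real.cos θ)) t :=
    ((hasDerivAt_id t).mul_const (Real.cos θ)).cos
  have h1 : HasDerivAt (fun s => Real.cos (s * Real.sin θ)) (-Real.sin (t * Real.sin θ) * (1 * Real.sin θ)) t :=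
    ((hasDerivAt_id t).mul_const (Real.sin θ)).cos
  have h := ((h0.add h1).const_mul (-2 : ℝ)).sub (((h0.mul h1).const_mul (4 * tp)))
  have hfun : kltpRay tp θ = (fun y => -2 * ((fun s => Real.cos (s * Real.cos θ)) + fun s => Real.cos (s * Real.sin θ)) y) -
      fun y => 4 * tp * (((fun s => Real.cos (s * Real.cos θ)) * fun s => Real.cos (s * Real.sin θ)) y) := by
    funext s
    simp only [kltpRay, Pi.add_apply, Pi.mul_apply, Pi.sub_apply]
    ring
  rw [hfun]
  refine h.congr_deriv ?_
  rw [kltpRayDt]; ring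

/-- The ray function is continuous in `t`. [folklore] -/
theorem continuous_kltpRay (tp θ : ℝ) : Continuous (kltpRay tp θ) := by
  unfold kltpRay; fun_prop

/-! ### §2 Radial strict monotonicity inside the open square, for every `|t′| < 1/2` -/

/-- **`∂_t F_{t′}(θ, t) > 0` for `0 < t` with `‖t · dir θ‖_∞ < π`, whenever `|t′| < 1/2`** (then `1 + 2t′cos ≥ 1 − 2|t′| > 0`, and `a sin (t a) ≥ 0`
with strict positivity on the coordinate realising the sup norm, exactly as at `t′ = 0`). [folklore] -/
theorem kltpRayDt_pos_of_lt_exit {tp θ t : ℝ} (htp : |tp| < 1 / 2) (ht : 0 < t) (h : t * ‖dir θ‖ < π) :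
    0 < kltpRayDt tp θ t := by
  have htp' := abs_lt.1 htp
  have hc : |t * Real.cos θ| ≤ t * ‖dir θ‖ := by
    rw [abs_mul, abs_of_pos ht, norm_dir]
    exact mul_le_mul_of_nonneg_left (le_max_left _ _) ht.le
  have hs : |t * Real.sin θ| ≤ t * ‖dir θ‖ := by
    rw [abs_mul, abs_of_pos ht, norm_dir]
    exact mul_le_mul_of_nonneg_left (le_max_right _ _) ht.le
  have hc0 : 0 ≤ Real.cos θ * Real.sin (t * Real.cos θ) := mul_sin_mul_nonneg ht.le (by linarith)
  have hs0 : 0 ≤ Real.sin θ * Real.sin (t * Real.sin θ) := mul_sin_mul_nonneg ht.le (by linarith)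
  have hf : ∀ y : ℝ, 0 < 1 + 2 * tp * Real.cos y := fun y => by
    have h1 : |tp * Real.cos y| ≤ |tp| := by
      rw [abs_mul]; exact mul_le_of_le_one_right (abs_nonneg tp) (Real.abs_cos_le_one y)
    have h2 := neg_abs_le (tp * Real.cos y)
    linarith
  have hf1 := hf (t * Real.sin θ)
  have hf0 := hf (t * Real.cos θ)
  unfold kltpRayDt
  rcases le_total |Real.sin θ| |Real.cos θ| with hle | hle
  · have hmax : ‖dir θ‖ = |Real.cos θ| := by rw [norm_dir, max_eq_left hle]
    have hne : Real.cos θ ≠ 0 := by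
      intro h0; have := norm_dir_pos θ; rw [hmax, h0, abs_zero] at this; exact lt_irrefl _ this
    have hlt : |t * Real.cos θ| < π := by rwa [abs_mul, abs_of_pos ht, ← hmax]
    have hpos := mul_sin_mul_pos ht hne hlt
    nlinarith [mul_pos hpos hf1, mul_nonneg hs0 hf0.le]
  · have hmax : ‖dir θ‖ = |Real.sin θ| := by rw [norm_dir, max_eq_right hle]
    have hne : Real.sin θ ≠ 0 := by
      intro h0; have := norm_dir_pos θ; rw [hmax, h0, abs_zero] at this; exact lt_irrefl _ this
    have hlt : |t * Real.sin θ| < π := by rwa [abs_mul, abs_of_pos ht, ← hmax]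
    have hpos := mul_sin_mul_pos ht hne hlt
    nlinarith [mul_pos hpos hf0, mul_nonneg hc0 hf1.le]

/-- **`t ↦ F_{t′}(θ, t)` is strictly increasing on `[0, π/‖dir θ‖]`** (the part of the ray in the closed square), `|t′| < 1/2`. [folklore] -/
theorem strictMonoOn_kltpRay {tp : ℝ} (htp : |tp| < 1 / 2) (θ : ℝ) :
    StrictMonoOn (kltpRay tp θ) (Icc 0 (π / ‖dir θ‖)) := by
  have hn := norm_dir_pos θ
  refine strictMonoOn_of_deriv_pos (convex_Icc _ _) (continuous_kltpRay tp θ).continuousOn fun t ht => ?_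
  rw [interior_Icc] at ht
  rw [(hasDerivAt_kltpRay tp θ t).deriv]
  exact kltpRayDt_pos_of_lt_exit htp ht.1 (by rw [← lt_div_iff₀ hn]; exact ht.2)

/-- At the centre `Γ`: `F_{t′}(θ, 0) = −4 − 4t′ = ε_{t′}(0, 0)`. [folklore] -/
theorem kltpRay_zero (tp θ : ℝ) : kltpRay tp θ 0 = -4 - 4 * tp := by
  simp [kltpRay]; ring

/-- **At the exit point the dispersion is at least the van Hove level**: `F_{t′}(θ, π/‖dir θ‖) ≥ 4t′` for `t′ < 1/2` (the coordinate realising the sup norm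
equals `±π`, where `cos = −1`, and `2 − (2 − 4t′) cos y ≥ 4t′`). [folklore] -/
theorem kltpRay_exit_ge {tp : ℝ} (htp : tp < 1 / 2) (θ : ℝ) : 4 * tp ≤ kltpRay tp θ (π / ‖dir θ‖) := by
  have hn := norm_dir_pos θ
  unfold kltpRay
  have hcos1 := Real.cos_le_one (π / ‖dir θ‖ * Real.cos θ)
  have hsin1 := Real.cos_le_one (π / ‖dir θ‖ * Real.sin θ)
  rcases le_total |Real.sin θ| |Real.cos θ| with hle | hle
  · have hmax : ‖dir θ‖ = |Real.cos θ| := by rw [norm_dir, max_eq_left hle]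
    have habs : |π / ‖dir θ‖ * Real.cos θ| = π := by
      rw [abs_mul, abs_div, abs_of_pos Real.pi_pos, abs_of_pos hn, ← hmax, div_mul_cancel₀ _ hn.ne']
    have hc : Real.cos (π / ‖dir θ‖ * Real.cos θ) = -1 := by
      rcases (abs_eq Real.pi_pos.le).1 habs with h | h
      · rw [h, Real.cos_pi]
      · rw [h, Real.cos_neg, Real.cos_pi]
    rw [hc]; nlinarith
  · have hmax : ‖dir θ‖ = |Real.sin θ| := by rw [norm_dir, max_eq_right hle]
    have habs : |π / ‖dir θ‖ * Real.sin θ| = π := by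
      rw [abs_mul, abs_div, abs_of_pos Real.pi_pos, abs_of_pos hn, ← hmax, div_mul_cancel₀ _ hn.ne']
    have hc : Real.cos (π / ‖dir θ‖ * Real.sin θ) = -1 := by
      rcases (abs_eq Real.pi_pos.le).1 habs with h | h
      · rw [h, Real.cos_pi]
      · rw [h, Real.cos_neg, Real.cos_pi]
    rw [hc]; nlinarith

/-! ### §3 The `t′` band Fermi radius on the Γ-pocket window `−4 − 4t′ < μ < 4t′` -/

/-- The defining property of the `t′` band Fermi radius along the ray of angle `θ`: a root of `F_{t′}(θ, t) = μ` with `t ≥ 0` in the closed square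
`‖t · dir θ‖_∞ ≤ π`. [folklore] -/
def IsKltpRadius (tp μ θ t : ℝ) : Prop := (0 ≤ t ∧ t * ‖dir θ‖ ≤ π) ∧ kltpRay tp θ t = μ

/-- Membership in the monotonicity interval. [folklore] -/
theorem IsKltpRadius.mem_Icc {tp μ θ t : ℝ} (h : IsKltpRadius tp μ θ t) : t ∈ Icc 0 (π / ‖dir θ‖) :=
  ⟨h.1.1, by rw [le_div_iff₀ (norm_dir_pos θ)]; exact h.1.2⟩

/-- **Existence and uniqueness of the `t′` band Fermi radius** along every ray, for `|t′| < 1/2` and every level in the Γ-pocket window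
`−4 − 4t′ < μ < 4t′` (between the band bottom `ε_{t′}(Γ)` and the van Hove level `ε_{t′}(π, 0)`). [folklore] -/
theorem existsUnique_isKltpRadius {tp μ : ℝ} (htp : |tp| < 1 / 2) (hμ₁ : -4 - 4 * tp < μ) (hμ₂ : μ < 4 * tp) (θ : ℝ) :
    ∃! t, IsKltpRadius tp μ θ t := by
  have hn := norm_dir_pos θ
  have hT : 0 < π / ‖dir θ‖ := div_pos Real.pi_pos hn
  have hcont : ContinuousOn (kltpRay tp θ) (Icc 0 (π / ‖dir θ‖)) := (continuous_kltpRay tp θ).continuousOn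
  have h0 : kltpRay tp θ 0 < μ := by rw [kltpRay_zero]; exact hμ₁
  have h1 : μ < kltpRay tp θ (π / ‖dir θ‖) := hμ₂.trans_le (kltpRay_exit_ge (abs_lt.1 htp).2 θ)
  obtain ⟨t, ht, hte⟩ : ∃ t ∈ Ioo 0 (π / ‖dir θ‖), kltpRay tp θ t = μ :=
    intermediate_value_Ioo hT.le hcont ⟨h0, h1⟩
  refine ⟨t, ⟨⟨ht.1.le, ?_⟩, hte⟩, ?_⟩
  · rw [← le_div_iff₀ hn]; exact ht.2.le
  · rintro s ⟨hs, hse⟩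
    have hsI : s ∈ Icc 0 (π / ‖dir θ‖) := ⟨hs.1, by rw [le_div_iff₀ hn]; exact hs.2⟩
    exact (strictMonoOn_kltpRay htp θ).injOn hsI ⟨ht.1.le, ht.2.le⟩ (hse.trans hte.symm)

/-- **The `t′` band Fermi radius `u_{t′,μ}(θ)`**: the polar radius of the Γ-centred Fermi curve `{ε_{t′} = μ}`, `−4 − 4t′ < μ < 4t′`, along the ray of angle `θ`
(Hilbert's `ε` of the defining property; unspecified junk outside the window).  At `t′ = 0` it is `bandFermiRadius μ θ` (`kltpRadius_zero_tp`). [folklore] -/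
def kltpRadius (tp μ θ : ℝ) : ℝ :=
  Classical.epsilon (IsKltpRadius tp μ θ)

section Window

variable {tp μ : ℝ} (htp : |tp| < 1 / 2) (hμ₁ : -4 - 4 * tp < μ) (hμ₂ : μ < 4 * tp)
include htp hμ₁ hμ₂

/-- The `t′` band Fermi radius has the defining property. [folklore] -/
theorem isKltpRadius_kltpRadius (θ : ℝ) : IsKltpRadius tp μ θ (kltpRadius tp μ θ) :=
  Classical.epsilon_spec (existsUnique_isKltpRadius htp hμ₁ hμ₂ θ).exists

/-- **`F_{t′}(θ, u(θ)) = μ`**: the polar curve lies on the level set. [folklore] -/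
theorem kltpRay_kltpRadius (θ : ℝ) : kltpRay tp θ (kltpRadius tp μ θ) = μ :=
  (isKltpRadius_kltpRadius htp hμ₁ hμ₂ θ).2

/-- Uniqueness: any admissible root is the `t′` band Fermi radius. [folklore] -/
theorem kltpRadius_unique {θ t : ℝ} (ht : IsKltpRadius tp μ θ t) : t = kltpRadius tp μ θ :=
  (existsUnique_isKltpRadius htp hμ₁ hμ₂ θ).unique ht (isKltpRadius_kltpRadius htp hμ₁ hμ₂ θ)

/-- `0 < u(θ)`. [folklore] -/
theorem kltpRadius_pos (θ : ℝ) : 0 < kltpRadius tp μ θ := by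
  rcases (isKltpRadius_kltpRadius htp hμ₁ hμ₂ θ).1.1.eq_or_lt with h | h
  · have := kltpRay_kltpRadius htp hμ₁ hμ₂ θ
    rw [← h, kltpRay_zero] at this
    linarith
  · exact h

/-- `u(θ) < π/‖dir θ‖`: the root lies strictly before the exit point. [folklore] -/
theorem kltpRadius_lt_exit (θ : ℝ) : kltpRadius tp μ θ < π / ‖dir θ‖ := by
  have hu := isKltpRadius_kltpRadius htp hμ₁ hμ₂ θ
  rcases hu.mem_Icc.2.lt_or_eq with h | h
  · exact h
  · have := kltpRay_exit_ge (abs_lt.1 htp).2 θ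
    rw [← h, hu.2] at this
    linarith

/-- **The curve lies in the open square**: `‖u(θ) · dir θ‖_∞ < π`. [folklore] -/
theorem norm_kltpRadius_smul_dir_lt (θ : ℝ) : ‖kltpRadius tp μ θ • dir θ‖ < π := by
  rw [norm_smul_dir (kltpRadius_pos htp hμ₁ hμ₂ θ).le, ← lt_div_iff₀ (norm_dir_pos θ)]
  exact kltpRadius_lt_exit htp hμ₁ hμ₂ θ

/-- Coordinates of the polar point lie in `(−π, π)`. [folklore] -/
theorem abs_kltpRadius_mul_dir_lt (θ : ℝ) (i : Fin 2) : |kltpRadius tp μ θ * dir θ i| < π :=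
  (abs_smul_dir_apply_le _ θ i).trans_lt (norm_kltpRadius_smul_dir_lt htp hμ₁ hμ₂ θ)

/-- Transversality: `∂_t F_{t′} > 0` at the polar point. [folklore] -/
theorem kltpRayDt_kltpRadius_pos (θ : ℝ) : 0 < kltpRayDt tp θ (kltpRadius tp μ θ) :=
  kltpRayDt_pos_of_lt_exit htp (kltpRadius_pos htp hμ₁ hμ₂ θ)
    (by rw [← lt_div_iff₀ (norm_dir_pos θ)]; exact kltpRadius_lt_exit htp hμ₁ hμ₂ θ)

end Window

/-! ### §4 The polar point and the Fermi curve; agreement with `bandFermiRadius` at `t′ = 0` -/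

/-- **The polar parametrisation of the Γ-centred `t′` Fermi curve**: the point `u_{t′,μ}(θ) (cos θ, sin θ)` of momentum space. [folklore] -/
def kltpPolar (tp μ θ : ℝ) : Momentum :=
  WithLp.toLp 2 (kltpRadius tp μ θ • dir θ)

/-- Coordinates of the polar point. [folklore] -/
@[simp] theorem kltpPolar_apply_zero (tp μ θ : ℝ) : kltpPolar tp μ θ 0 = kltpRadius tp μ θ * Real.cos θ := by
  simp [kltpPolar]

/-- Coordinates of the polar point. [folklore] -/
@[simp] theorem kltpPolar_apply_one (tp μ θ : ℝ) : kltpPolar tp μ θ 1 = kltpRadius tp μ θ * Real.sin θ := by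
  simp [kltpPolar]

/-- **The polar point lies on the Fermi curve** `fermiCurve (squareDispersion 1 t′) μ` (in the Brillouin zone `[−π, π)²` and on the level set). [folklore] -/
theorem kltpPolar_mem_fermiCurve {tp μ : ℝ} (htp : |tp| < 1 / 2) (hμ₁ : -4 - 4 * tp < μ) (hμ₂ : μ < 4 * tp) (θ : ℝ) :
    kltpPolar tp μ θ ∈ fermiCurve (squareDispersion 1 tp) μ := by
  refine ⟨fun i => ?_, ?_⟩
  · have h := abs_lt.1 (abs_kltpRadius_mul_dir_lt htp hμ₁ hμ₂ θ i)
    have hcoord : kltpPolar tp μ θ i = kltpRadius tp μ θ * dir θ i := by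
      fin_cases i <;> simp [kltpPolar]
    rw [hcoord]
    exact ⟨h.1.le, h.2⟩
  · show squareDispersion 1 tp (kltpPolar tp μ θ) = μ
    rw [kltpPolar, squareDispersion_toLp_smul_dir]
    exact kltpRay_kltpRadius htp hμ₁ hμ₂ θ

/-- **At `t′ = 0` the `t′` band radius IS the tree's `bandFermiRadius`** (`−4 < μ < 0`). [folklore] -/
theorem kltpRadius_zero_tp {μ : ℝ} (hμ₁ : -4 < μ) (hμ₂ : μ < 0) (θ : ℝ) : kltpRadius 0 μ θ = bandFermiRadius μ θ := by
  have htp : |(0 : ℝ)| < 1 / 2 := by norm_num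
  have h1 : -4 - 4 * (0 : ℝ) < μ := by linarith
  have h2 : μ < 4 * (0 : ℝ) := by linarith
  have hb := isBandFermiRadius_bandFermiRadius hμ₁ hμ₂ θ
  symm
  refine kltpRadius_unique htp h1 h2 ⟨hb.1, ?_⟩
  rw [kltpRay_zero_tp]
  exact hb.2

/-- And the polar points agree: `kltpPolar 0 μ θ = fermiPolar μ θ`. [folklore] -/
theorem kltpPolar_zero_tp {μ : ℝ} (hμ₁ : -4 < μ) (hμ₂ : μ < 0) (θ : ℝ) : kltpPolar 0 μ θ = fermiPolar μ θ := by
  rw [kltpPolar, fermiPolar, kltpRadius_zero_tp hμ₁ hμ₂]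

/-! ### §5 The HOLE POCKET about `M = (π, π)` (`t′ < 0`, `4t′ < μ < 4 − 4t′`) via the particle–hole shift -/

/-- **The polar point of the hole pocket about `M`**: the `(π, π)`-shift (`klphShift`, reduced to the zone) of the Γ-centred polar point of the REFLECTED band
`(−t′, −μ)` — by `ε_{t′}(T k) = −ε_{−t′}(k)` the M-pocket of `ε_{t′}` at level `μ` is the image of the Γ-pocket of `ε_{−t′}` at level `−μ`. [folklore] -/
def kltpPocketPolar (tp μ θ : ℝ) : Momentum :=
  klphShift (kltpPolar (-tp) (-μ) θ)

/-- **The pocket polar point lies on the Fermi curve** `fermiCurve (squareDispersion 1 t′) μ` for `|t′| < 1/2` and `4t′ < μ < 4 − 4t′` (the window between the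
van Hove level `ε_{t′}(π, 0) = 4t′` and the band top `ε_{t′}(π, π) = 4 − 4t′`; e.g. `t′ = −3/10`, `μ ∈ (−6/5, 26/5)` ∋ the `(⅛, −0.3)` cell). [folklore] -/
theorem kltpPocketPolar_mem_fermiCurve {tp μ : ℝ} (htp : |tp| < 1 / 2) (hμ₁ : 4 * tp < μ) (hμ₂ : μ < 4 - 4 * tp) (θ : ℝ) :
    kltpPocketPolar tp μ θ ∈ fermiCurve (squareDispersion 1 tp) μ := by
  have htp' : |(-tp)| < 1 / 2 := by rwa [abs_neg]
  have h := kltpPolar_mem_fermiCurve htp' (μ := -μ) (by linarith) (by linarith) θ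
  have hpre : kltpPolar (-tp) (-μ) θ ∈ klphShift ⁻¹' fermiCurve (squareDispersion 1 tp) μ := by
    rw [klphShift_preimage_fermiCurve]; exact h
  exact hpre

/-- The pocket radius is positive and the pocket point is not `M`'s zone representative shifted by zero: `0 < u_{−t′,−μ}(θ) < π/‖dir θ‖`. [folklore] -/
theorem kltpPocketRadius_pos_lt {tp μ : ℝ} (htp : |tp| < 1 / 2) (hμ₁ : 4 * tp < μ) (hμ₂ : μ < 4 - 4 * tp) (θ : ℝ) :
    0 < kltpRadius (-tp) (-μ) θ ∧ kltpRadius (-tp) (-μ) θ < π / ‖dir θ‖ := by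
  have htp' : |(-tp)| < 1 / 2 := by rwa [abs_neg]
  exact ⟨kltpRadius_pos htp' (by linarith) (by linarith) θ, kltpRadius_lt_exit htp' (by linarith) (by linarith) θ⟩

end Summit.HubbardSuperconductivity.HubbardSuperconductivity.Theorems

end
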